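import Summits.BirchSwinnertonDyer.BirchSwinnertonDyer.Theorems.AdditiveBranchIMCGordTwoRankZeroCompanionRecord119952ea1
import Literature.NumberTheory.EllipticCurves.Fisher2012.HesseFamilyThreeReverseProofs
import HarnessLib

/-!
# `119952ea1 @ 3` — the companion/visibility record with its `3`-CONGRUENCE PROVED IN THE KERNEL (θ discharged UNCONDITIONALLY (Fisher 2012 Thm. 13.2 for `n = 3` is PROVED in the tree — no named fact enters for θ))

Cell `bsd-addord`, seat `bsd-addord-k1-c2` (D-0074 row B1, crux `GordTwoRankZeroOffCaseOne` = item 19357), gen 6. HONEST FRAMING: nothing here proves the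
Birch–Swinnerton-Dyer conjecture or the crux; THEOREMS ONLY (no definition, no named fact, no `sorry`); per pair; NOT a class theorem; nothing booked.
The partner `F` of `…AdditiveBranchIMCGordTwoRankZeroCompanionRecord119952ea1` is `ℚ`-isomorphic to the member `(λ : μ) = (204624 : 588)`, `u = 1` of the DUAL Hesse pencil `X_E⁻(3)` (§9/§13, reverse; tree-PROVED `thm132rev_threeCongruent_dualHessePencil_holds`) of `E`;
certificate found EXACTLY (rational roots of the covariant/j-condition; kit j268961, script `work/cert/job/main.py` of this seat) and checked here by
`norm_num` / `decide +kernel` on the tree's forms; the remaining binders are those of the `…_of_congr` theorems minus `θ`, `hθ`. [cite: Fisher2012Hessian, Thm. 13.2 (n = 3) and §9, §13] [cite: MazurRubin2015SelmerCompanions, Thm. 3.1]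
-/

set_option autoImplicit false

noncomputable section

open scoped Classical

open WeierstrassCurve Literature.NumberTheory.EllipticCurves
  Literature.NumberTheory.EllipticCurves.Rank1Residual
  Literature.NumberTheory.EllipticCurves.Rank1Residual.Typed
  Literature.NumberTheory.EllipticCurves.Rank1Residual.X11RankOneCertificates
  Literature.NumberTheory.EllipticCurves.Wuthrich2014
  Literature.NumberTheory.EllipticCurves.MazurRubin2015
  Literature.NumberTheory.EllipticCurves.ModularForms
  Literature.NumberTheory.GaloisRepresentations
  Summit.BirchSwinnertonDyer.BirchSwinnertonDyer.Rank1Residual.IntModel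
  Summit.BirchSwinnertonDyer.Rank1Residual.X11b
  Summit.BirchSwinnertonDyer.Rank1Residual.GaloisImage
  Summit.BirchSwinnertonDyer.Rank1Residual.Supersingular
  Summit.BirchSwinnertonDyer.Rank1Residual.SecondDescent
open NumberField IsDedekindDomain Rat.HeightOneSpectrum Field
open Summit.BirchSwinnertonDyer.Rank1Residual.Supersingular.LocalOddTorsion

set_option linter.dupNamespace false

open Literature.NumberTheory.EllipticCurves.Fisher2012
namespace Summit.BirchSwinnertonDyer.BirchSwinnertonDyer.Theorems.AdditiveBranchIMCGordTwoRankZeroCompanion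

open Summit.BirchSwinnertonDyer.Rank1Residual
open Summit.BirchSwinnertonDyer.Rank1Residual.Additive

/-- **`ord_3 #Ш(E)_an ≤ ord_3 #Ш(E)` for `E = 119952ea1` with the `3`-congruence `F[3] ≃ E[3]` PROVED IN THE KERNEL** UNCONDITIONALLY (Fisher 2012 Thm. 13.2 for `n = 3` is PROVED in the tree — no named fact enters for θ): `(λ : μ) = (204624 : 588)`, `u = 1` (family 2). Everything else as in
`missingLowerBoundAt_c119952ea1_3_of_congr`. Per pair; nothing booked. [cite: Fisher2012Hessian, Thm. 13.2 (n = 3) and §9, §13] [cite: MazurRubin2015SelmerCompanions, Thm. 3.1] -/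
theorem missingLowerBoundAt_c119952ea1_3
    (hCT : exists_casselsTate_pairing (K := ℚ)) (hGZK : rank_eq_analyticRank_of_analyticRank_le_one)
    (hMRt : selmerLocalKer_iff_of_twist_of_goodReduction_above) {W F : WeierstrassCurve ℚ} [W.IsElliptic] [W.IsGloballyMinimal] [F.IsElliptic]
    [F.IsGloballyMinimal] (hWeq : W = ⟨0, 0, 0, -31899, -2741942⟩) (hFeq : F = ⟨0, 0, 0, 4533, -22790⟩) (hr0 : W.analyticRank = 0) {q : ℚ}
    (hq : shaAn W = (q : ℂ)) (hv : padicValRat 3 q ≤ 2) :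
    MissingLowerBoundAt W 3 := by
  have hc4 : W.c₄ = (1531152 : ℚ) := by
    subst hWeq; norm_num [WeierstrassCurve.c₄, WeierstrassCurve.b₂, WeierstrassCurve.b₄]
  have hc6 : W.c₆ = (2369037888 : ℚ) := by
    subst hWeq; norm_num [WeierstrassCurve.c₆, WeierstrassCurve.b₂, WeierstrassCurve.b₄, WeierstrassCurve.b₆]
  have hc4F : F.c₄ = (-217584 : ℚ) := by
    subst hFeq; norm_num [WeierstrassCurve.c₄, WeierstrassCurve.b₂, WeierstrassCurve.b₄]
  have hc6F : F.c₆ = (19690560 : ℚ) := by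
    subst hFeq; norm_num [WeierstrassCurve.c₆, WeierstrassCurve.b₂, WeierstrassCurve.b₄, WeierstrassCurve.b₆]
  obtain ⟨θ, hθ⟩ := threeCongruent_of_dualHesseCertificate_unconditional W F (204624 : ℚ) (588 : ℚ) (1 : ℚ) (by norm_num)
    (by rw [hc4, hc6, hc4F, eval_hesseD3]; norm_num) (by rw [hc4, hc6, hc6F, eval_hesseC6three]; norm_num)
  exact missingLowerBoundAt_c119952ea1_3_of_congr hCT hGZK hMRt hWeq hFeq hr0 hq hv θ hθ

end Summit.BirchSwinnertonDyer.BirchSwinnertonDyer.Theorems.AdditiveBranchIMCGordTwoRankZeroCompanion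

end
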